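import Summits.QuantumFields.YangMills.Theorems.UnitScaleTiltProp7CombTreeRatioLinearResponse
import Summits.QuantumFields.YangMills.Theorems.UnitScaleTiltProp7CornerCombStructure
import HarnessLib

/-!
# Route `UnitScaleTilt`, crux K1 «MinimiserStabilityRegPr» (stmt-QuantumFields-19200), route-R E′ (A′)-on-Σ, P-A2 (β), row `hMcomb₂` ⟸ H2-1 — file H-1
# «THE SINGLE-BAR LINEAR RESPONSE OF PRINT's COMB TOWER IS THE LINEARISED CORNERED TOWER»: for ANY bondwise-differentiable perturbation family `Z` through `1`,
# **`D[Ṽ(c)[V₀, Z(·)]](a) v = T_{V₀}(Ż_v)(c)`** with `T_{V₀}` the cornered one-step true derivative of ✓`Prop7CombTildTrueLin` WRITTEN OUT, hence level by level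
# **`fderiv ℂ (t ↦ ↑(Ũˡ[U₁ t](z, κ))) a v = Q l (U̇₁,v) z κ`** for ★routeR-w1's linearised-tower family `Q` of ✓`Prop7CornerCombStructure` (its recursion texts VERBATIM)

Cell `ym3-torus` (HUMAN RULING D-0037: YM₃ on the torus is ladder rung R3 — not d = 4, not a mass gap, not Clay), width seat `ym3-torus-px17` (gen 4); ★★OWNER RULINGS №20 (1) (`hMcomb₂`),
№22 (c); ★routeR-w1 g9 07:08:36Z («px13 g6 ∕ px17 g4: … H2-1's supplier can be stated over (A-1)»).  `--supports stmt-QuantumFields-19200 --as helper`; THEOREMS ONLY (0 `def`,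
0 `sorry`); count-neutral.  «route-internal row (n3)-comb₂ — NOT N06, NOT a print row; OPEN».  Nothing of `hMcomb`, `hMcomb₂`, H2-1, (β), `hPA2`, `hcoS`, E′, EX, the crux,
d = 4 or the gap is claimed.

THE POINT.  px13 g6's SIGNATURE-0′ `hMcomb₂` measures PRINT's single bars `Ũˡ = tildIter L W♯ (e^{A})♯ l` ([Balaban1985Averaging] (65)∕(68)∕(69)) against their Fréchet derivative
`fderiv ℂ (A′ ↦ ↑(Ũˡ[(e^{A′})♯](ẑ, κ))) 0 (iX)`; ★routeR-w1 g9's (O2) program (MASTER memo §4) telescopes `Ũˡ − 1 − Lin_l(·)` through the composites `T_{l−1} ∘ ⋯ ∘ T_0` of the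
cornered one-step TRUE derivatives `T_j` (F-2b ✓`Prop7CombTildTrueLin.norm_tildIter_succ_sub_one_sub_trueLin_le`'s operator; family `Q` of F-4 ✓`Prop7CornerCombStructure.
exists_linTower_family`).  This file proves the two linear parts are THE SAME OBJECT: the derivative of (65) along any differentiable family is `T_{V₀}` applied to the family's
velocity field (§1: product∕chain rule over F-2b's `coe_tild_eq` ∘ `coe_expUnit_Xavg_eq_eml` ((42) IS `eml`), lit ✓`Wcx_eq_hol_loop`, ★routeR-w2 g9's (3ᶜ)
✓`Prop7CombTreeRatioLinearResponse.exists_hasFDerivAt_tHol` for the twisted transports (58), lit ✓`ExpMeanLog.analyticAt_eml` for the mean), read at level `j → j+1`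
through lit ✓`tildIter_succ` ((68), §2), and iterated (§3).  Lit ✓`B7Prop3GeneralTild.hasDerivAt_tild_expCfg` is the RAY `e^{tA}` at ONE level in the `PhiY∕DXavg` form (119);
the tower needs general families (level `j`'s perturbation `t ↦ Ũʲ[U₁ t]` is not a ray) and F-2b's `fderiv ℂ eml` form — hence this file.  Differentiability of every level
follows from level 0 alone (an analyticity-free twin of ★routeR-w2's (2ᶜ) `hT` under the unit loop window).

WHAT IS PROVED (ns `…Theorems.Prop7CombTildLinearResponse`; `𝔸` any C⋆-algebra; every `d`, `L`; any units background).
* §1 `coe_tild_family_eq` ((65) along a family = `eml(loop ratios · W₀) · (seg ratio) · κ₀⁻¹`), ★★ `exists_hasFDerivAt_tild`, `fderiv_coe_tild_apply`.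
* §2 ★★ `exists_hasFDerivAt_tildIter_succ`, `differentiableAt_coe_tildIter_succ`, `fderiv_coe_tildIter_succ_apply` (level `j → j+1`, background `Ū₀ʲ = avgIter L U₀ j`, corner `L•z`).
* §3 ★★★ `fderiv_coe_tildIter_eq_linTower` — `∀ l ≤ n`, differentiability AND `fderiv … a v = Q l (U̇₁,v) z κ`, under the loop window `‖W(Ū₀ᵏ) − 1‖ < 1` below `n` and the texts
  `hQ0`∕`hQs` of ✓`Prop7CornerCombStructure` VERBATIM.
HONEST SCOPE.  Calculus identities; no estimate; the windows are displayed (discharged at `RegPr` by ★routeR-w6 ✓`comb_level_rows_of_regPr` ∕ ✓px17 `…CombTowerUnitaryOfSkew` in the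
member file).  H2-1 (the `ℓ¹` propagation of the second-order defects through `Q`) stays OPEN and is NOT advanced here.  Rung R3, not Clay; YM gap NOT proved.

References: T. Bałaban, CMP **98** (1985) 17–51 [Balaban1985Averaging] ((42) p.23, (58) p.27, (65)∕(68)∕(69) p.29, (111)–(113) p.34, (117)–(119) p.35); CMP **109** (1987)
249–301 [Balaban1987RG1] ((0.4)–(0.8) p.253).
-/

set_option autoImplicit false

noncomputable section

open scoped BigOperators

namespace Summit.QuantumFields.YangMills.Theorems.Prop7CombTildLinearResponse

open NormedSpace
open Literature.MathematicalPhysics.QuantumFieldTheory.Balaban1983to89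
open ExpMeanLog (eml analyticAt_eml)
open B7Prop1Explicit (Site Letter hol seg boxVec gammaWord Wcx Xavg expUnit)
open B7Prop2Explicit (avgIter)
open B7Eq92Concrete (tild tHol tildIter tildIter_succ tildIter_zero')
open B7Prop3GeneralRotated (tsum)
open B7GaugeFixingAtBackground (tildIter_one_right)
open Summit.QuantumFields.YangMills.Theorems.Prop7CombTildTrueLin (coe_tild_eq coe_expUnit_Xavg_eq_eml)
open Summit.QuantumFields.YangMills.Theorems.Prop7CombTreeRatioLinearResponse (exists_hasFDerivAt_tHol)

variable {E : Type*} [NormedAddCommGroup E] [NormedSpace ℂ E]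
variable {d : ℕ} {𝔸 : Type*} [CStarAlgebra 𝔸]

/-! ## §1 One averaging step (65) along a differentiable family -/

section OneStep

variable (L : ℕ) (V₀ : Site d → Fin d → 𝔸ˣ) (Z : E → Site d → Fin d → 𝔸ˣ) {a : E}

/-- The twisted transport (58) of the unit configuration is `1`. [cite: Balaban1985Averaging, (58) p.27] -/
theorem tHol_one_right' (y : Site d) (w : List (Letter d)) : tHol V₀ (1 : Site d → Fin d → 𝔸ˣ) y w = 1 := by
  rw [tHol, one_mul, mul_inv_cancel]

/-- **(65) ALONG A FAMILY, FACTORED THROUGH THE TWISTED TRANSPORTS (58)**: `Ṽ(c)[V₀, V₁] = eml(r ↦ (R_{0,c₋}V₁)(Γ_{c,x_r} ∪ (−c)) · W₀,r) · (R_{0,c₋}V₁)([c₋,c₊]) · (exp X_c[V₀])⁻¹`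
(F-2b `coe_tild_eq` ∘ `coe_expUnit_Xavg_eq_eml`; the loop of the product field is the twisted transport times the background loop, lit `Wcx_eq_hol_loop`).
[cite: Balaban1985Averaging, (65) p.29, (42) p.23, (58) p.27] -/
theorem coe_tild_family_eq (V₁ : Site d → Fin d → 𝔸ˣ) (q : Site d) (κ : Fin d) :
    ((tild L V₀ V₁ q κ : 𝔸ˣ) : 𝔸)
      = eml (fun r : Fin d → Fin L =>
            ((tHol V₀ V₁ q (gammaWord L κ (boxVec L r) ++ seg κ (-(L : ℤ))) : 𝔸ˣ) : 𝔸) * ((Wcx L V₀ q κ (boxVec L r) : 𝔸ˣ) : 𝔸))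
          * ((tHol V₀ V₁ q (seg κ (L : ℤ)) : 𝔸ˣ) : 𝔸) * (((expUnit (Xavg L V₀ q κ))⁻¹ : 𝔸ˣ) : 𝔸) := by
  rw [coe_tild_eq, coe_expUnit_Xavg_eq_eml]
  have hloop : (fun r : Fin d → Fin L => ((Wcx L (V₁ * V₀) q κ (boxVec L r) : 𝔸ˣ) : 𝔸))
      = fun r => ((tHol V₀ V₁ q (gammaWord L κ (boxVec L r) ++ seg κ (-(L : ℤ))) : 𝔸ˣ) : 𝔸) * ((Wcx L V₀ q κ (boxVec L r) : 𝔸ˣ) : 𝔸) := by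
    funext r
    rw [B7Prop1Explicit.Wcx_eq_hol_loop, B7Prop1Explicit.Wcx_eq_hol_loop, tHol, ← Units.val_mul, inv_mul_cancel_right]
  have hseg : ((hol (V₁ * V₀) q (seg κ (L : ℤ)) : 𝔸ˣ) : 𝔸) * (((hol V₀ q (seg κ (L : ℤ)))⁻¹ : 𝔸ˣ) : 𝔸)
      = ((tHol V₀ V₁ q (seg κ (L : ℤ)) : 𝔸ˣ) : 𝔸) := by
    rw [tHol, Units.val_mul]
  rw [hloop, ← hseg]
  simp only [mul_assoc]

/-- ★★ **THE DERIVATIVE OF PRINT's SINGLE BAR (65) ALONG ANY DIFFERENTIABLE FAMILY IS THE CORNERED ONE-STEP TRUE DERIVATIVE OF THE VELOCITY**: background `V₀` (units) with the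
block loops `W₀,r = V₀(Γ_{c,x_r})V₀(c)⁻¹` at `c = (q, κ)` in the unit window of the series logarithm; a units family `Z` with `Z a = 1` and bondwise derivatives `Z′`.  Then
`t ↦ ↑(Ṽ(c)[V₀, Z t])` has a derivative `D` at `a` with
`D v = D eml(W₀)[r ↦ (R_{0,c₋}Ż_v)(Γ_{c,x_r} ∪ (−c))·W₀,r]·κ₀⁻¹ + κ₀·(R_{0,c₋}Ż_v)([c₋, c₊])·κ₀⁻¹`, `κ₀ = exp X_c[V₀]`, `Ż_v(x, μ) := Z′ x μ v` — F-2b's operator VERBATIM.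
[cite: Balaban1985Averaging, (65) p.29, (111)-(113) p.34, (117)-(119) p.35; Balaban1987RG1, (0.8) p.253] -/
theorem exists_hasFDerivAt_tild (hZa : Z a = 1) {Z' : Site d → Fin d → E →L[ℂ] 𝔸}
    (hZ : ∀ x κ, HasFDerivAt (fun t => ((Z t x κ : 𝔸ˣ) : 𝔸)) (Z' x κ) a) (q : Site d) (κ : Fin d)
    (hW : ∀ r : Fin d → Fin L, ‖((Wcx L V₀ q κ (boxVec L r) : 𝔸ˣ) : 𝔸) - 1‖ < 1) :
    ∃ D : E →L[ℂ] 𝔸, HasFDerivAt (fun t => ((tild L V₀ (Z t) q κ : 𝔸ˣ) : 𝔸)) D a ∧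
      ∀ v : E, D v
        = fderiv ℂ (eml : ((Fin d → Fin L) → 𝔸) → 𝔸) (fun r => ((Wcx L V₀ q κ (boxVec L r) : 𝔸ˣ) : 𝔸))
              (fun r => tsum V₀ (fun x μ => Z' x μ v) q (gammaWord L κ (boxVec L r) ++ seg κ (-(L : ℤ))) * ((Wcx L V₀ q κ (boxVec L r) : 𝔸ˣ) : 𝔸))
              * (((expUnit (Xavg L V₀ q κ))⁻¹ : 𝔸ˣ) : 𝔸)
            + ((expUnit (Xavg L V₀ q κ) : 𝔸ˣ) : 𝔸) * tsum V₀ (fun x μ => Z' x μ v) q (seg κ (L : ℤ))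
              * (((expUnit (Xavg L V₀ q κ))⁻¹ : 𝔸ˣ) : 𝔸) := by
  -- letters
  set W₀ : (Fin d → Fin L) → 𝔸 := fun r => ((Wcx L V₀ q κ (boxVec L r) : 𝔸ˣ) : 𝔸) with hW₀
  set κ₀ : 𝔸ˣ := expUnit (Xavg L V₀ q κ) with hκ₀
  -- the twisted transports along the loops and the segment
  have hl : ∀ r : Fin d → Fin L, ∃ D : E →L[ℂ] 𝔸,
      HasFDerivAt (fun t => ((tHol V₀ (Z t) q (gammaWord L κ (boxVec L r) ++ seg κ (-(L : ℤ))) : 𝔸ˣ) : 𝔸)) D a ∧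
        ∀ v : E, D v = tsum V₀ (fun x μ => Z' x μ v) q (gammaWord L κ (boxVec L r) ++ seg κ (-(L : ℤ))) :=
    fun r => exists_hasFDerivAt_tHol V₀ Z hZa hZ q _
  choose Dl hDl hDlv using hl
  obtain ⟨Ds, hDs, hDsv⟩ := exists_hasFDerivAt_tHol V₀ Z hZa hZ q (seg κ (L : ℤ))
  -- the tuple of loop ratios times the background loops
  set Φ : E → (Fin d → Fin L) → 𝔸 := fun t r =>
    ((tHol V₀ (Z t) q (gammaWord L κ (boxVec L r) ++ seg κ (-(L : ℤ))) : 𝔸ˣ) : 𝔸) * W₀ r with hΦ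
  have hΦd : HasFDerivAt Φ (ContinuousLinearMap.pi fun r => (Dl r).smulRight (W₀ r)) a :=
    hasFDerivAt_pi.2 fun r => (hDl r).mul_const' (W₀ r)
  have hΦa : Φ a = W₀ := by
    funext r
    simp only [hΦ, hZa, tHol_one_right', Units.val_one, one_mul]
  -- the mean
  have heml : HasFDerivAt (eml : ((Fin d → Fin L) → 𝔸) → 𝔸) (fderiv ℂ eml W₀) (Φ a) := by
    rw [hΦa]
    exact (analyticAt_eml hW).differentiableAt.hasFDerivAt
  have hF : HasFDerivAt (fun t => eml (Φ t)) ((fderiv ℂ eml W₀).comp (ContinuousLinearMap.pi fun r => (Dl r).smulRight (W₀ r))) a :=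
    heml.comp a hΦd
  -- the product
  have hFG := (hF.mul' hDs).mul_const' (((κ₀⁻¹ : 𝔸ˣ)) : 𝔸)
  have heq : (fun t => ((tild L V₀ (Z t) q κ : 𝔸ˣ) : 𝔸))
      = fun t => eml (Φ t) * ((tHol V₀ (Z t) q (seg κ (L : ℤ)) : 𝔸ˣ) : 𝔸) * (((κ₀⁻¹ : 𝔸ˣ)) : 𝔸) := by
    funext t
    rw [coe_tild_family_eq]
  refine ⟨_, by rw [heq]; exact hFG, fun v => ?_⟩
  have hFa : eml (Φ a) = ((κ₀ : 𝔸ˣ) : 𝔸) := by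
    rw [hΦa, hκ₀, coe_expUnit_Xavg_eq_eml]
  have hGa : ((tHol V₀ (Z a) q (seg κ (L : ℤ)) : 𝔸ˣ) : 𝔸) = 1 := by
    rw [hZa, tHol_one_right', Units.val_one]
  simp only [smul_apply, add_apply, ContinuousLinearMap.comp_apply, MulOpposite.smul_eq_mul_unop, MulOpposite.unop_op, smul_eq_mul, hFa, hGa,
    hDsv v, mul_one]
  have hpi : (ContinuousLinearMap.pi fun r => (Dl r).smulRight (W₀ r)) v
      = fun r => tsum V₀ (fun x μ => Z' x μ v) q (gammaWord L κ (boxVec L r) ++ seg κ (-(L : ℤ))) * ((Wcx L V₀ q κ (boxVec L r) : 𝔸ˣ) : 𝔸) := by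
    funext r
    rw [ContinuousLinearMap.pi_apply, ContinuousLinearMap.smulRight_apply, hDlv r v, smul_eq_mul]
  rw [hpi, add_mul, add_comm]

/-- ★★ **APPLIED FORM** of `exists_hasFDerivAt_tild` under bondwise differentiability. [cite: Balaban1985Averaging, (65) p.29, (119) p.35] -/
theorem fderiv_coe_tild_apply (hZa : Z a = 1) (hZ : ∀ x κ, DifferentiableAt ℂ (fun t => ((Z t x κ : 𝔸ˣ) : 𝔸)) a) (q : Site d) (κ : Fin d)
    (hW : ∀ r : Fin d → Fin L, ‖((Wcx L V₀ q κ (boxVec L r) : 𝔸ˣ) : 𝔸) - 1‖ < 1) (v : E) :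
    DifferentiableAt ℂ (fun t => ((tild L V₀ (Z t) q κ : 𝔸ˣ) : 𝔸)) a ∧
    fderiv ℂ (fun t => ((tild L V₀ (Z t) q κ : 𝔸ˣ) : 𝔸)) a v
      = fderiv ℂ (eml : ((Fin d → Fin L) → 𝔸) → 𝔸) (fun r => ((Wcx L V₀ q κ (boxVec L r) : 𝔸ˣ) : 𝔸))
            (fun r => tsum V₀ (fun x μ => fderiv ℂ (fun t => ((Z t x μ : 𝔸ˣ) : 𝔸)) a v) q (gammaWord L κ (boxVec L r) ++ seg κ (-(L : ℤ)))
              * ((Wcx L V₀ q κ (boxVec L r) : 𝔸ˣ) : 𝔸))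
            * (((expUnit (Xavg L V₀ q κ))⁻¹ : 𝔸ˣ) : 𝔸)
          + ((expUnit (Xavg L V₀ q κ) : 𝔸ˣ) : 𝔸) * tsum V₀ (fun x μ => fderiv ℂ (fun t => ((Z t x μ : 𝔸ˣ) : 𝔸)) a v) q (seg κ (L : ℤ))
            * (((expUnit (Xavg L V₀ q κ))⁻¹ : 𝔸ˣ) : 𝔸) := by
  obtain ⟨D, hD, hDv⟩ := exists_hasFDerivAt_tild L V₀ Z hZa (fun x κ => (hZ x κ).hasFDerivAt) q κ hW
  exact ⟨hD.differentiableAt, by rw [hD.fderiv, hDv]⟩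

end OneStep

/-! ## §2 Level `j → j+1` of print's comb tower (68) -/

section Level

variable (L : ℕ) (U₀ : Site d → Fin d → 𝔸ˣ) (U₁ : E → Site d → Fin d → 𝔸ˣ) {a : E}

/-- ★★ **LEVEL `j → j+1`**: if `U₁ a = 1` and the level-`j` single bars `t ↦ ↑(Ũʲ[U₁ t](x, μ))` have derivatives `T x μ` at `a` bondwise, and the block loops of `Ū₀ʲ` at the
corner `L•z` are in the unit window, then `t ↦ ↑(Ũʲ⁺¹[U₁ t](z, κ))` has a derivative `D` at `a` with `D v = T_{Ū₀ʲ}(x μ ↦ T x μ v)(L•z, κ)` ((68): `Ũʲ⁺¹ = Ṽ[Ū₀ʲ, Ũʲ]`, lit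
✓`tildIter_succ`, then §1). [cite: Balaban1985Averaging, (68)-(69) p.29, (119) p.35] -/
theorem exists_hasFDerivAt_tildIter_succ (hU₁ : U₁ a = 1) (j : ℕ) {T : Site d → Fin d → E →L[ℂ] 𝔸}
    (hT : ∀ x μ, HasFDerivAt (fun t => ((tildIter L U₀ (U₁ t) j x μ : 𝔸ˣ) : 𝔸)) (T x μ) a) (z : Site d) (κ : Fin d)
    (hW : ∀ r : Fin d → Fin L, ‖((Wcx L (avgIter L U₀ j) ((L : ℤ) • z) κ (boxVec L r) : 𝔸ˣ) : 𝔸) - 1‖ < 1) :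
    ∃ D : E →L[ℂ] 𝔸, HasFDerivAt (fun t => ((tildIter L U₀ (U₁ t) (j + 1) z κ : 𝔸ˣ) : 𝔸)) D a ∧
      ∀ v : E, D v
        = fderiv ℂ (eml : ((Fin d → Fin L) → 𝔸) → 𝔸) (fun r => ((Wcx L (avgIter L U₀ j) ((L : ℤ) • z) κ (boxVec L r) : 𝔸ˣ) : 𝔸))
              (fun r => tsum (avgIter L U₀ j) (fun x μ => T x μ v) ((L : ℤ) • z) (gammaWord L κ (boxVec L r) ++ seg κ (-(L : ℤ)))
                * ((Wcx L (avgIter L U₀ j) ((L : ℤ) • z) κ (boxVec L r) : 𝔸ˣ) : 𝔸))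
              * (((expUnit (Xavg L (avgIter L U₀ j) ((L : ℤ) • z) κ))⁻¹ : 𝔸ˣ) : 𝔸)
            + ((expUnit (Xavg L (avgIter L U₀ j) ((L : ℤ) • z) κ) : 𝔸ˣ) : 𝔸) * tsum (avgIter L U₀ j) (fun x μ => T x μ v) ((L : ℤ) • z) (seg κ (L : ℤ))
              * (((expUnit (Xavg L (avgIter L U₀ j) ((L : ℤ) • z) κ))⁻¹ : 𝔸ˣ) : 𝔸) := by
  have hZa : (fun t => tildIter L U₀ (U₁ t) j) a = 1 := by
    show tildIter L U₀ (U₁ a) j = 1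
    rw [hU₁, tildIter_one_right]
  have heq : (fun t => ((tildIter L U₀ (U₁ t) (j + 1) z κ : 𝔸ˣ) : 𝔸))
      = fun t => ((tild L (avgIter L U₀ j) ((fun t => tildIter L U₀ (U₁ t) j) t) ((L : ℤ) • z) κ : 𝔸ˣ) : 𝔸) := by
    funext t; rw [tildIter_succ]
  obtain ⟨D, hD, hDv⟩ := exists_hasFDerivAt_tild L (avgIter L U₀ j) (fun t => tildIter L U₀ (U₁ t) j) hZa hT ((L : ℤ) • z) κ hW
  exact ⟨D, by rw [heq]; exact hD, hDv⟩

/-- Differentiability at level `j + 1` from bondwise differentiability at level `j`. [cite: Balaban1985Averaging, (68)-(69) p.29] -/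
theorem differentiableAt_coe_tildIter_succ (hU₁ : U₁ a = 1) (j : ℕ)
    (hT : ∀ x μ, DifferentiableAt ℂ (fun t => ((tildIter L U₀ (U₁ t) j x μ : 𝔸ˣ) : 𝔸)) a) (z : Site d) (κ : Fin d)
    (hW : ∀ r : Fin d → Fin L, ‖((Wcx L (avgIter L U₀ j) ((L : ℤ) • z) κ (boxVec L r) : 𝔸ˣ) : 𝔸) - 1‖ < 1) :
    DifferentiableAt ℂ (fun t => ((tildIter L U₀ (U₁ t) (j + 1) z κ : 𝔸ˣ) : 𝔸)) a := by
  obtain ⟨D, hD, -⟩ := exists_hasFDerivAt_tildIter_succ L U₀ U₁ hU₁ j (fun x μ => (hT x μ).hasFDerivAt) z κ hW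
  exact hD.differentiableAt

/-- ★★ **APPLIED FORM AT LEVEL `j → j+1`**: `fderiv ℂ (t ↦ ↑(Ũʲ⁺¹[U₁ t](z,κ))) a v = T_{Ū₀ʲ}(x μ ↦ fderiv ℂ (t ↦ ↑(Ũʲ[U₁ t](x,μ))) a v)(L•z, κ)`.
[cite: Balaban1985Averaging, (68)-(69) p.29, (119) p.35] -/
theorem fderiv_coe_tildIter_succ_apply (hU₁ : U₁ a = 1) (j : ℕ)
    (hT : ∀ x μ, DifferentiableAt ℂ (fun t => ((tildIter L U₀ (U₁ t) j x μ : 𝔸ˣ) : 𝔸)) a) (z : Site d) (κ : Fin d)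
    (hW : ∀ r : Fin d → Fin L, ‖((Wcx L (avgIter L U₀ j) ((L : ℤ) • z) κ (boxVec L r) : 𝔸ˣ) : 𝔸) - 1‖ < 1) (v : E) :
    fderiv ℂ (fun t => ((tildIter L U₀ (U₁ t) (j + 1) z κ : 𝔸ˣ) : 𝔸)) a v
      = fderiv ℂ (eml : ((Fin d → Fin L) → 𝔸) → 𝔸) (fun r => ((Wcx L (avgIter L U₀ j) ((L : ℤ) • z) κ (boxVec L r) : 𝔸ˣ) : 𝔸))
            (fun r => tsum (avgIter L U₀ j) (fun x μ => fderiv ℂ (fun t => ((tildIter L U₀ (U₁ t) j x μ : 𝔸ˣ) : 𝔸)) a v) ((L : ℤ) • z)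
                (gammaWord L κ (boxVec L r) ++ seg κ (-(L : ℤ)))
              * ((Wcx L (avgIter L U₀ j) ((L : ℤ) • z) κ (boxVec L r) : 𝔸ˣ) : 𝔸))
            * (((expUnit (Xavg L (avgIter L U₀ j) ((L : ℤ) • z) κ))⁻¹ : 𝔸ˣ) : 𝔸)
          + ((expUnit (Xavg L (avgIter L U₀ j) ((L : ℤ) • z) κ) : 𝔸ˣ) : 𝔸)
              * tsum (avgIter L U₀ j) (fun x μ => fderiv ℂ (fun t => ((tildIter L U₀ (U₁ t) j x μ : 𝔸ˣ) : 𝔸)) a v) ((L : ℤ) • z) (seg κ (L : ℤ))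
            * (((expUnit (Xavg L (avgIter L U₀ j) ((L : ℤ) • z) κ))⁻¹ : 𝔸ˣ) : 𝔸) := by
  obtain ⟨D, hD, hDv⟩ := exists_hasFDerivAt_tildIter_succ L U₀ U₁ hU₁ j (fun x μ => (hT x μ).hasFDerivAt) z κ hW
  rw [hD.fderiv, hDv]

end Level

/-! ## §3 ★★★ All levels: the linear response IS the linearised cornered tower -/

section Tower

variable (L : ℕ) (U₀ : Site d → Fin d → 𝔸ˣ) (U₁ : E → Site d → Fin d → 𝔸ˣ) {a : E}

/-- ★★★ **THE SINGLE-BAR LINEAR RESPONSE OF PRINT's COMB TOWER IS ★routeR-w1's LINEARISED CORNERED TOWER.**  Let `U₁` be a units family with `U₁ a = 1`, bondwise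
differentiable at `a` at level `0`, velocity `U̇₁,v(x, μ) := fderiv ℂ (t ↦ ↑(U₁ t x μ)) a v`; let `Q` be ANY family with the recursion texts of ✓`Prop7CornerCombStructure.
exists_linTower_family` (`Q 0 Y = Y`, `Q (k+1) Y (z,κ) = T_k(Q k Y)(L•z, κ)` with `T_k` the cornered one-step true derivative at `Ū₀ᵏ`, written out); suppose the block loops of
`Ū₀ᵏ` are in the unit window of the series logarithm for every `k < n`.  THEN for every `l ≤ n` and every bond `(z, κ)`: `t ↦ ↑(Ũˡ[U₁ t](z, κ))` is differentiable at `a` and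
**`fderiv ℂ (t ↦ ↑(Ũˡ[U₁ t](z, κ))) a v = Q l U̇₁,v z κ`**.  With `U₁ A := (e^{A})♯`, `a = 0`, `v = iX` this reads px13's SIGNATURE-0′ linear part as `Q l ((iX)♯)` (the member
file).  [cite: Balaban1985Averaging, (68)-(69) p.29, (119) p.35, (43) p.24; Balaban1987RG1, (0.4) p.253] -/
theorem fderiv_coe_tildIter_eq_linTower (hU₁ : U₁ a = 1) (h0 : ∀ x μ, DifferentiableAt ℂ (fun t => ((U₁ t x μ : 𝔸ˣ) : 𝔸)) a)
    (Q : ℕ → (Site d → Fin d → 𝔸) → Site d → Fin d → 𝔸) (hQ0 : ∀ Y, Q 0 Y = Y)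
    (hQs : ∀ (k : ℕ) (Y : Site d → Fin d → 𝔸) (z : Site d) (κ : Fin d), Q (k + 1) Y z κ
        = fderiv ℂ (eml : ((Fin d → Fin L) → 𝔸) → 𝔸) (fun r => ((Wcx L (avgIter L U₀ k) ((L : ℤ) • z) κ (boxVec L r) : 𝔸ˣ) : 𝔸))
              (fun r => tsum (avgIter L U₀ k) (Q k Y) ((L : ℤ) • z) (gammaWord L κ (boxVec L r) ++ seg κ (-(L : ℤ)))
                * ((Wcx L (avgIter L U₀ k) ((L : ℤ) • z) κ (boxVec L r) : 𝔸ˣ) : 𝔸))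
              * (((expUnit (Xavg L (avgIter L U₀ k) ((L : ℤ) • z) κ))⁻¹ : 𝔸ˣ) : 𝔸)
            + ((expUnit (Xavg L (avgIter L U₀ k) ((L : ℤ) • z) κ) : 𝔸ˣ) : 𝔸) * tsum (avgIter L U₀ k) (Q k Y) ((L : ℤ) • z) (seg κ (L : ℤ))
              * (((expUnit (Xavg L (avgIter L U₀ k) ((L : ℤ) • z) κ))⁻¹ : 𝔸ˣ) : 𝔸))
    {n : ℕ} (hW : ∀ k : ℕ, k < n → ∀ (z : Site d) (κ : Fin d) (r : Fin d → Fin L),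
      ‖((Wcx L (avgIter L U₀ k) ((L : ℤ) • z) κ (boxVec L r) : 𝔸ˣ) : 𝔸) - 1‖ < 1) (v : E) :
    ∀ l : ℕ, l ≤ n →
      (∀ (z : Site d) (κ : Fin d), DifferentiableAt ℂ (fun t => ((tildIter L U₀ (U₁ t) l z κ : 𝔸ˣ) : 𝔸)) a) ∧
      ∀ (z : Site d) (κ : Fin d), fderiv ℂ (fun t => ((tildIter L U₀ (U₁ t) l z κ : 𝔸ˣ) : 𝔸)) a v
        = Q l (fun x μ => fderiv ℂ (fun t => ((U₁ t x μ : 𝔸ˣ) : 𝔸)) a v) z κ := by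
  intro l
  induction l with
  | zero =>
    intro _
    refine ⟨fun z κ => ?_, fun z κ => ?_⟩
    · simp only [tildIter_zero']
      exact h0 z κ
    · simp only [tildIter_zero', hQ0]
  | succ l ih =>
    intro hl
    obtain ⟨hdiff, hfd⟩ := ih (Nat.le_of_succ_le hl)
    have hWl : ∀ (z : Site d) (κ : Fin d) (r : Fin d → Fin L),
        ‖((Wcx L (avgIter L U₀ l) ((L : ℤ) • z) κ (boxVec L r) : 𝔸ˣ) : 𝔸) - 1‖ < 1 := hW l (Nat.lt_of_succ_le hl)
    refine ⟨fun z κ => differentiableAt_coe_tildIter_succ L U₀ U₁ hU₁ l hdiff z κ (hWl z κ), fun z κ => ?_⟩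
    have hfun : (fun x μ => fderiv ℂ (fun t => ((tildIter L U₀ (U₁ t) l x μ : 𝔸ˣ) : 𝔸)) a v)
        = Q l (fun x μ => fderiv ℂ (fun t => ((U₁ t x μ : 𝔸ˣ) : 𝔸)) a v) := by
      funext x μ; exact hfd x μ
    rw [fderiv_coe_tildIter_succ_apply L U₀ U₁ hU₁ l hdiff z κ (hWl z κ) v, hfun, hQs]

end Tower

end Summit.QuantumFields.YangMills.Theorems.Prop7CombTildLinearResponse

end
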